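import Summits.ResolutionOfSingularities.ResolutionOfSingularities.Theorems.FrobeniusLadderFInjectiveMacaulayficationRingVeronese
import Summits.ResolutionOfSingularities.ResolutionOfSingularities.Theorems.FrobeniusLadderFInjectiveMacaulayficationCoactionReesAway
import Mathlib.RingTheory.Localization.Away.Basic
import HarnessLib

/-!
# `A′ ≅ T[Y, Y⁻¹]` and the packaged Rees–Veronese interface, ring level (crux `FInjectiveMacaulayfication`, §17 (F3))

Support file for crux stmt-ResolutionOfSingularities-15315 (`FrobeniusLadder.FInjectiveMacaulayfication`,
filtered engine §17 / G4♮, CRUX-PLAN w45a v5 §1.3 piece (F3), owner stub-4). [OURS · L1 W4.5a]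

RING-LEVEL twins of `…CoactionReesAwayRange.exists_awayEquiv_of_range` and `…ReesInterface.reesInterface`, for a
Laurent coaction `β : B →+* B[T;T⁻¹]` on the ring `B` itself (the `(w,-1)`-grading of the filtered extended Rees
algebra `T′♮`; see `…RingVeronese`):

* `exists_awayEquiv_ring` — for an abstract commutative ring `T` with an injective ring map `j : T →+* B` onto the
  degree-`0` part and a unit `U` of `B` homogeneous of degree `N > 0`: `e : Localization.Away (X : T[X]) ≃+* A′` with
  `e (C t) = j t`, `e X = U` (`A′` the `N`-Veronese subalgebra) — injective by independence of homogeneous elements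
  of the distinct degrees `dN`, surjective by decomposition into components;
* `reesInterfaceRing` — the bundle consumed by `GradedChartClauseAssembly.chartClause_core_affine` (stub-2): Veronese
  subalgebra `A′` with `B` integral over it and an `A′`-linear retraction, `b₀ ^ N ∈ A′` for the degree-`-1` element
  `b₀` (`= s`), a ring `T` (bound together with its `CommRing` instance — continuation-passing style, see
  `…ReesInterface` for why) with `ι : C ≃+* T`, `e : T[Y][1/Y] ≃+* A′`, and `e⁻¹(b₀^N) ∈ (ι u₀)` whenever
  `ι u₀ = U · b₀^N` in `B`. Inputs from the carrier: `β` with counit/coassociativity/`k` in degree `0`, homogeneous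
  generators, `b₀`, the unit `U` (`= X_v^c`), the degree-`0` subalgebra `T₀` and `ι : C ≃+* T₀` ((F0), (F2)).

Folklore; no definitions, no named facts.
-/

-- single-problem summit: the doubled namespace component is forced
set_option linter.dupNamespace false

noncomputable section

open scoped LaurentPolynomial Polynomial
open AddMonoidAlgebra LaurentPolynomial
open Summit.ResolutionOfSingularities.ResolutionOfSingularities.Theorems.FInjectiveMacaulayfication
open Summit.ResolutionOfSingularities.ResolutionOfSingularities.Theorems.FInjectiveMacaulayfication.LaurentCoaction
open Summit.ResolutionOfSingularities.ResolutionOfSingularities.Theorems.FInjectiveMacaulayfication.CoactionRees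
open Summit.ResolutionOfSingularities.ResolutionOfSingularities.Theorems.FInjectiveMacaulayfication.RingVeronese

namespace Summit.ResolutionOfSingularities.ResolutionOfSingularities.Theorems.FInjectiveMacaulayfication.RingVeroneseAway

variable {k B : Type} [Field k] [CommRing B] [Algebra k B] (β : B →+* B[T;T⁻¹])
  (hε : ∀ b : B, LaurentPolynomial.eval₂ (RingHom.id B) 1 (β b) = b)
  (hΔ : ∀ (b : B) (i : ℤ), β ((β b).coeff i) = single i ((β b).coeff i))
  (N : ℕ)

/-- The bridge at ring level: if `b` is `β̄`-homogeneous of degree `0̄` then every non-zero `β`-component of `b`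
has degree divisible by `N`. [folklore] -/
theorem dvd_of_coeff_ne_zero (hΔ : ∀ (b : B) (i : ℤ), β ((β b).coeff i) = single i ((β b).coeff i)) {b : B}
    (h : (mapDomainRingHom B (Int.castAddHom (ZMod N))).comp β b = single 0 b)
    {i : ℤ} (hi : (β b).coeff i ≠ 0) : (N : ℤ) ∣ i := by
  have h' : (mapDomainRingHom B (Int.castAddHom (ZMod N))).comp β b = single ((0 : ℕ) : ZMod N) b := by
    rw [Nat.cast_zero]; exact h
  have hd := CoactionReesAway.dvd_sub_of_coeff_ne_zero β hΔ N h' hi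
  rwa [Nat.cast_zero, sub_zero] at hd

section Away

variable (T : Type) [CommRing T] (j : T →+* B) (hj : Function.Injective j) (A' : Subalgebra k B)
  (hT : ∀ b : B, b ∈ Set.range j ↔ β b = single 0 b)
  (hA' : ∀ b : B, b ∈ A' ↔ (mapDomainRingHom B (Int.castAddHom (ZMod N))).comp β b = single 0 b)

include hε hΔ hj hT hA' in
/-- **`A′` is the Laurent polynomial ring over the degree-zero part (ring level, abstract-model form).** For `T` a
commutative ring with an injective ring map `j : T →+* B` onto the degree-`0` part and a unit `U` of `B` homogeneous of
degree `N > 0`, there is a ring isomorphism `e : (T[X])[1/X] ≃+* A′` with `e (C t) = j t` and `e X = U`. [folklore] -/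
theorem exists_awayEquiv_ring (hN : 0 < N) (U V : B) (hUV : U * V = 1) (hU : β U = single (N : ℤ) U) :
    ∃ e : Localization.Away (Polynomial.X : Polynomial T) ≃+* A',
      (∀ t : T, ((e (algebraMap (Polynomial T) (Localization.Away (Polynomial.X : Polynomial T))
        (Polynomial.C t)) : A') : B) = j t) ∧
      ((e (algebraMap (Polynomial T) (Localization.Away (Polynomial.X : Polynomial T))
        Polynomial.X) : A') : B) = U := by
  classical
  have hjA : ∀ t : T, j t ∈ A' := fun t =>
    mem_veronese_of_hom β N A' hA' ((hT (j t)).mp ⟨t, rfl⟩) (dvd_zero _)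
  have hV : β V = single (-(N : ℤ)) V := hom_of_mul_eq_one hUV hU
  have hUA : U ∈ A' := mem_veronese_of_hom β N A' hA' hU (dvd_refl _)
  have hVA : V ∈ A' := mem_veronese_of_hom β N A' hA' hV (dvd_neg.mpr (dvd_refl _))
  let x : A' := ⟨U, hUA⟩
  let y : A' := ⟨V, hVA⟩
  have hxy : x * y = 1 := Subtype.ext hUV
  let i : T →+* A' := j.codRestrict A' hjA
  have hi : ∀ t : T, ((i t : A') : B) = j t := fun t => rfl
  let g : Polynomial T →+* A' := Polynomial.eval₂RingHom i x
  have hgC : ∀ t : T, g (Polynomial.C t) = i t := fun t => Polynomial.eval₂_C _ _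
  have hgX : g Polynomial.X = x := Polynomial.eval₂_X _ _
  have hunit : IsUnit (g Polynomial.X) := by rw [hgX]; exact .of_mul_eq_one y hxy
  let e₀ : Localization.Away (Polynomial.X : Polynomial T) →+* A' := IsLocalization.Away.lift Polynomial.X hunit
  have he₀ : ∀ P : Polynomial T, e₀ (algebraMap _ _ P) = g P := fun P => IsLocalization.Away.lift_eq _ hunit P
  -- `g` is injective: homogeneous elements of the distinct degrees `d N` are independent
  have hginj : ∀ P : Polynomial T, g P = 0 → P = 0 := by
    intro P hP
    have hval : ((g P : A') : B) = ∑ d ∈ P.support, j (P.coeff d) * U ^ d := by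
      show ((Polynomial.eval₂ i x P : A') : B) = _
      rw [Polynomial.eval₂_eq_sum, Polynomial.sum, AddSubmonoidClass.coe_finsetSum]
      refine Finset.sum_congr rfl fun d _ => ?_
      rw [Subalgebra.coe_mul, Subalgebra.coe_pow]
      rfl
    have hsum : ∑ d ∈ P.support, j (P.coeff d) * U ^ d = 0 := by
      rw [← hval, hP, Subalgebra.coe_zero]
    have hdeg : ∀ d ∈ P.support, β (j (P.coeff d) * U ^ d) = single ((0 : ℤ) + (d : ℤ) * N) (j (P.coeff d) * U ^ d) :=
      fun d _ => hom_mul ((hT _).mp ⟨P.coeff d, rfl⟩) (hom_pow hU d)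
    have hinjd : Set.InjOn (fun d : ℕ => (0 : ℤ) + (d : ℤ) * N) P.support := by
      intro a _ b _ hab
      have hN' : (N : ℤ) ≠ 0 := by exact_mod_cast hN.ne'
      have : (a : ℤ) = b := mul_right_cancel₀ hN' (by simpa using hab)
      exact_mod_cast this
    refine Polynomial.ext fun d => ?_
    rw [Polynomial.coeff_zero]
    by_cases hd : d ∈ P.support
    · have h := eq_zero_of_sum_hom_eq_zero P.support _ _ hinjd hdeg hsum d hd
      apply (injective_iff_map_eq_zero j).mp hj
      calc j (P.coeff d) = j (P.coeff d) * (U * V) ^ d := by rw [hUV, one_pow, mul_one]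
        _ = 0 := by rw [mul_pow, ← mul_assoc, h, zero_mul]
    · exact Polynomial.notMem_support_iff.mp hd
  -- the image of `X⁻¹` is `V`
  let Xinv : Localization.Away (Polynomial.X : Polynomial T) := IsLocalization.Away.invSelf (Polynomial.X : Polynomial T)
  have hw : ((e₀ Xinv : A') : B) = V := by
    have h1 : e₀ (algebraMap (Polynomial T) _ Polynomial.X) * e₀ Xinv = 1 := by
      rw [← map_mul]
      show e₀ (algebraMap _ _ (Polynomial.X : Polynomial T) * IsLocalization.Away.invSelf (Polynomial.X : Polynomial T)) = 1
      rw [IsLocalization.Away.mul_invSelf, map_one]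
    rw [he₀, hgX] at h1
    have h2 : e₀ Xinv = y := by
      calc e₀ Xinv = y * x * e₀ Xinv := by rw [mul_comm y x, hxy, one_mul]
        _ = y := by rw [mul_assoc, h1, mul_one]
    rw [h2]
  -- homogeneous elements of degree divisible by `N` are attained
  have key : ∀ (b : B) (i' : ℤ), β b = single i' b → (N : ℤ) ∣ i' → ∃ z, ((e₀ z : A') : B) = b := by
    intro b i' hb hdiv
    obtain ⟨d, hd⟩ := hdiv
    rcases Int.eq_nat_or_neg d with ⟨d', rfl | rfl⟩
    · have hb' : β (V ^ d' * b) = single 0 (V ^ d' * b) := by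
        have h := hom_mul (hom_pow hV d') hb
        have hjm : (d' : ℤ) * -(N : ℤ) + i' = 0 := by rw [hd]; ring
        rwa [hjm] at h
      obtain ⟨t, ht⟩ := (hT _).mpr hb'
      refine ⟨algebraMap _ _ (Polynomial.X ^ d' * Polynomial.C t), ?_⟩
      rw [he₀, map_mul, map_pow, hgX, hgC, Subalgebra.coe_mul, Subalgebra.coe_pow, hi, ht]
      show U ^ d' * (V ^ d' * b) = b
      rw [← mul_assoc, ← mul_pow, hUV, one_pow, one_mul]
    · have hb' : β (U ^ d' * b) = single 0 (U ^ d' * b) := by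
        have h := hom_mul (hom_pow hU d') hb
        have hjm : (d' : ℤ) * (N : ℤ) + i' = 0 := by rw [hd]; ring
        rwa [hjm] at h
      obtain ⟨t, ht⟩ := (hT _).mpr hb'
      refine ⟨Xinv ^ d' * algebraMap _ _ (Polynomial.C t), ?_⟩
      rw [map_mul, map_pow, he₀, hgC, Subalgebra.coe_mul, Subalgebra.coe_pow, hw, hi, ht]
      show V ^ d' * (U ^ d' * b) = b
      rw [← mul_assoc, ← mul_pow, mul_comm V U, hUV, one_pow, one_mul]
  -- surjectivity: every `a ∈ A′` is the sum of its components, of degrees divisible by `N`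
  have hsurj : Function.Surjective e₀ := by
    intro a
    suffices h : (a : B) ∈ (e₀.range.map (A'.val : A' →+* B)) by
      obtain ⟨b, ⟨z, rfl⟩, hb⟩ := Subring.mem_map.mp h
      exact ⟨z, Subtype.ext hb⟩
    rw [← sum_coeff_eq β hε (a : B)]
    refine Subring.sum_mem _ fun i' hi' => ?_
    obtain ⟨z, hz⟩ := key _ i' (hΔ _ i')
      (dvd_of_coeff_ne_zero β N hΔ ((hA' _).mp a.2) (Finsupp.mem_support_iff.mp hi'))
    exact Subring.mem_map.mpr ⟨e₀ z, ⟨z, rfl⟩, hz⟩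
  have hinj : Function.Injective e₀ := by
    rw [injective_iff_map_eq_zero]
    intro z hz
    induction z using Localization.induction_on with
    | H yy =>
      obtain ⟨P, s⟩ := yy
      rw [Localization.mk_eq_mk'] at hz ⊢
      have h := IsLocalization.mk'_spec (Localization.Away (Polynomial.X : Polynomial T)) P s
      apply_fun e₀ at h
      rw [map_mul, hz, zero_mul, he₀] at h
      rw [hginj P h.symm, IsLocalization.mk'_zero]
  refine ⟨RingEquiv.ofBijective e₀ ⟨hinj, hsurj⟩, fun t => ?_, ?_⟩
  · rw [RingEquiv.ofBijective_apply, he₀, hgC, hi]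
  · rw [RingEquiv.ofBijective_apply, he₀, hgX]

end Away

include hε hΔ in
/-- **THE REES–VERONESE INTERFACE, RING LEVEL** (G4♮ pieces (F1)+(F3) packaged for
`GradedChartClauseAssembly.chartClause_core_affine`; continuation-passing, `T` bound with its instance — see the module
docstring and `…ReesInterface`). [folklore] -/
theorem reesInterfaceRing (hk : ∀ c : k, β (algebraMap k B c) = LaurentPolynomial.C (algebraMap k B c))
    (hN : 0 < N) (U V : B) (hUV : U * V = 1) (hU : β U = single (N : ℤ) U)
    (G : Set B) (hG : ∀ g ∈ G, ∃ d : ℤ, β g = single d g) (hgen : Algebra.adjoin k G = ⊤)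
    (b₀ : B) (hb₀ : β b₀ = single (-1 : ℤ) b₀)
    (T₀ : Subalgebra k B) (hT₀ : ∀ b : B, b ∈ T₀ ↔ β b = single 0 b)
    {C : Type} [CommRing C] (ι : C ≃+* T₀) (u₀ : C) (hιu : ((ι u₀ : T₀) : B) = U * b₀ ^ N)
    (P : Prop)
    (hP : ∀ (A' : Subalgebra k B) [Algebra.IsIntegral A' B] (ρ : B →ₗ[A'] A'),
      (∀ x : A', ρ (x : B) = x) → ∀ (hsN : b₀ ^ N ∈ A')
      (T : Type) [CommRing T] (ι' : C ≃+* T) (e : Localization.Away (Polynomial.X : Polynomial T) ≃+* A'),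
      e.symm ⟨b₀ ^ N, hsN⟩ ∈ Ideal.span {algebraMap (Polynomial T)
        (Localization.Away (Polynomial.X : Polynomial T)) (Polynomial.C (ι' u₀))} → P) : P := by
  classical
  have hV : β V = single (-(N : ℤ)) V := hom_of_mul_eq_one hUV hU
  -- the Veronese subalgebra `A′`, retraction, `b₀^N ∈ A′`, `V ∈ A′`, integrality
  obtain ⟨A', hA'⟩ := exists_degSubalgebra (k := k) ((mapDomainRingHom B (Int.castAddHom (ZMod N))).comp β)
    (mapDomain_algebraMap β _ hk)
  obtain ⟨ρ, hρ⟩ := exists_retraction_ring ((mapDomainRingHom B (Int.castAddHom (ZMod N))).comp β)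
    (coassoc_mapDomain β _ hΔ) A' hA'
  have hsN : b₀ ^ N ∈ A' := pow_mem_veronese β N A' hA' hb₀
  have hVA : V ∈ A' := mem_veronese_of_hom β N A' hA' hV (dvd_neg.mpr (dvd_refl _))
  haveI : Algebra.IsIntegral A' B := isIntegral_veronese_ring β N A' hA' hN G hG hgen
  -- `e : (↥T₀)[Y][1/Y] ≃+* A′` through the abstract-model lemma with `T := ↥T₀`, `j := T₀.val`
  have hj : Function.Injective (T₀.val.toRingHom : ↥T₀ →+* B) := fun a b h => Subtype.ext h
  have hTr : ∀ b : B, b ∈ Set.range (T₀.val.toRingHom : ↥T₀ →+* B) ↔ β b = single 0 b := by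
    intro b
    rw [← hT₀ b]
    constructor
    · rintro ⟨t, rfl⟩
      exact t.2
    · intro hb
      exact ⟨⟨b, hb⟩, rfl⟩
  obtain ⟨e, heC, -⟩ := exists_awayEquiv_ring β hε hΔ N ↥T₀ (T₀.val.toRingHom : ↥T₀ →+* B) hj A' hTr hA'
    hN U V hUV hU
  refine hP A' ρ hρ hsN ↥T₀ ι e ?_
  -- the compatibility: `b₀^N = V · (ι u₀)` in `A′`, and `e (C t) = t`
  have hVU : V * U = 1 := by rw [mul_comm]; exact hUV
  have h1 : (⟨b₀ ^ N, hsN⟩ : ↥A') = ⟨V, hVA⟩ *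
      e (algebraMap (Polynomial ↥T₀) (Localization.Away (Polynomial.X : Polynomial ↥T₀)) (Polynomial.C (ι u₀))) :=
    Subtype.ext (by
      rw [Subalgebra.coe_mul, heC]
      show b₀ ^ N = V * ((ι u₀ : T₀) : B)
      rw [hιu, ← mul_assoc, hVU, one_mul])
  rw [Ideal.mem_span_singleton']
  exact ⟨e.symm ⟨V, hVA⟩, by rw [h1, RingEquiv.map_mul, RingEquiv.symm_apply_apply]⟩

end Summit.ResolutionOfSingularities.ResolutionOfSingularities.Theorems.FInjectiveMacaulayfication.RingVeroneseAway

end
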